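import Mathlib
import HarnessLib
import Summits.Ventures.LatticeQCDFlow.Exactness.TransformedKernel
import Summits.Ventures.LatticeQCDFlow.Scoring.CloverChargeMeanZero
import Summits.Ventures.LatticeQCDFlow.Scoring.HMCKernelSymmetry

/-!
# A symmetry of the update decouples odd from even observables at every lag: `⟨A(X₀) B(X_n)⟩ = 0` for `A` odd, `B` even

HONEST FRAMING: exact (Metropolis-corrected) sampling algorithms for lattice gauge theory;
figures of merit are autocorrelation/cost numbers at stated couplings and volumes; no
continuum-physics claim.

Venture `LatticeQCDFlow` (cell pub-lqcd), topic `Exactness`, FANOUT row 21 (`su3-base`: the baselines report `τ_int(Q²)`,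
`τ_int(Q)` and `τ_int(t²E)` as SEPARATE figures of merit — the topological charge `Q` is odd under the lattice
reflections / axis transpositions of the tree, `Q²`, the plaquette and the flowed energy are even).  NEW WORK of the cell
over row 7's `Exactness/TransformedKernel` (`conjKernel κ F` = the update reported through a measurable bijection,
`conjKernel_nHit`, `integral_conjKernel`, `correlation_conjKernel`), `Exactness/InvariantComposition` (`nHit`) and row 16's
`Scoring/CloverChargeMeanZero` (`integral_eq_zero_of_measurePreserving_odd`).  IN THE TREE ALREADY, NOT RESTATED: row 16's
`Scoring/SymmetricSamplerOddObservables` — the ONE-TIME statements (a `Θ`-symmetric kernel from a `Θ`-invariant start keeps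
every odd observable centred with symmetric law at every step; `map_bind_nHit_eq_self`, `conjKernel_comp_eq_self`), row 14's
`Exactness/KernelSymmetry` — where the hypothesis comes from (`conjKernel_involMH_of_comm`: an involutive-Metropolis kernel
with an equivariant proposal and invariant energy is `Θ`-symmetric; refresh–update–forget kernels), row 16's
`Scoring/HMCKernelSymmetry` (arm E2's HMC kernel commutes with the time reflection).  THIS file is the TWO-TIME statement
(lagged cross-moments of an odd and an even observable), which none of them contains.  Def-free: "the update `κ` is
`θ`-symmetric" is the hypothesis `conjKernel κ θ = κ` (`θ : Ω ≃ᵐ Ω`), "the start is `θ`-symmetric" is `ν.map θ = ν`.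
Nothing is cited as a fact; no number.

## What is proved (`κ : Kernel Ω Ω`, `θ : Ω ≃ᵐ Ω`, `ν` a measure on `Ω`, real observables `A`, `B`)

* §1 `crossCorrelation_conjKernel_nHit` — the two-observable form of row 7's dictionary:
  `∫ A · (Kⁿ B) d(F_*ν) = ∫ (A∘F) · (κⁿ (B∘F)) dν`, `K = conjKernel κ F` (any measurable bijection `F`).
* §2 symmetric updates: `conjKernel_nHit_of_symm` (`κ` `θ`-symmetric ⇒ `κⁿ` `θ`-symmetric; compositions are row 16's
  `Scoring.conjKernel_comp_eq_self`), `integral_nHit_apply_symm` (`(κⁿg)(θx) = (κⁿ(g∘θ))(x)`), **`nHit_odd`** / **`nHit_even`** — `κⁿ` maps `θ`-odd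
  observables to `θ`-odd ones and `θ`-even to `θ`-even.
* §3 **`integral_mul_nHit_eq_zero_of_odd_even`** / **`_of_even_odd`** — for a `θ`-symmetric update `κ`, a `θ`-invariant
  `ν`, `A` odd and `B` even (or the other way round): `∫ A(x) · (κⁿ B)(x) dν(x) = 0` FOR EVERY LAG `n` — the stationary
  lagged cross-moment `𝔼_ν[A(X₀) B(X_n)]` of the chain vanishes identically; with row 16's
  `integral_eq_zero_of_measurePreserving_odd` (`𝔼_ν[A] = 0`) this is **`crossCov_nHit_eq_zero_of_odd_even`**: the lagged cross-COVARIANCE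
  `𝔼[A(X₀)B(X_n)] − 𝔼[A]𝔼[B(X_n)]` is `0` at every lag, in both orders.
* §4 ARM E2 INSTANCE (row 16's `hmcKernel`, `conjKernel_hmcKernel`, `sum_cloverPseudoscalar_iterate_wilsonFlowRK3_negReflect`):
  **`rk3CloverCharge_mul_nHit_sq_eq_zero`** — under every `Θ'`-invariant law the measured flowed charge `Q_{ε',m}` and its square are
  uncorrelated at every lag; **`rk3CloverCharge_mul_nHit_sq_hmcChain_eq_zero`** — `𝔼[Q(U_N)·Q²(U_{N+k})] = 0` at EVERY step `N` and lag
  `k` of the run from any `Θ'`-invariant start; cold / hot start corollaries.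
So for any exact algorithm whose update commutes with a symmetry flipping `Q` (and any symmetric start, e.g. equilibrium),
the lagged covariance matrix of `(Q, Q², E, plaquette, …)` is block-diagonal between the odd and the even sector at every
lag: `τ_int(Q²)` and `τ_int(E)` are properties of the even sector alone and are neither bounded by nor bound `τ_int(Q)`
through cross terms.  NOT CLAIMED: arm E1 (a fixed lexicographic heat-bath/overrelaxation sweep is not `Θ'`-symmetric as an ordered product); any inequality between `τ_int(Q)` and
`τ_int(Q²)`; integrability bookkeeping beyond what the identities need (none: they hold with Bochner's junk value too).
-/

noncomputable section

namespace Summit.Ventures.LatticeQCDFlow.Exactness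

open MeasureTheory ProbabilityTheory ProbabilityTheory.Kernel

variable {Ω Ω' : Type*} [MeasurableSpace Ω] [MeasurableSpace Ω']

/-! ## §1 The two-observable dictionary of a reported update -/

/-- **`∫ A · (Kⁿ B) d(F_*ν) = ∫ (A∘F) · (κⁿ (B∘F)) dν`** with `K = conjKernel κ F`, for every pair of real observables and
every lag (row 7's `correlation_conjKernel_nHit` is the case `A = B`). -/
theorem crossCorrelation_conjKernel_nHit (κ : Kernel Ω Ω) (F : Ω ≃ᵐ Ω') (ν : Measure Ω) (A B : Ω' → ℝ) (n : ℕ) :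
    ∫ x, A x * (∫ y, B y ∂(nHit (conjKernel κ F) n x)) ∂(ν.map F) =
      ∫ v, A (F v) * (∫ w, B (F w) ∂(nHit κ n v)) ∂ν := by
  rw [← conjKernel_nHit, integral_map_equiv]
  simp only [integral_conjKernel, MeasurableEquiv.symm_apply_apply]

/-! ## §2 Symmetric updates preserve parity -/

section Symm

variable {κ : Kernel Ω Ω} {θ : Ω ≃ᵐ Ω}

/-- Powers of a `θ`-symmetric update are `θ`-symmetric. -/
theorem conjKernel_nHit_of_symm (hκ : conjKernel κ θ = κ) (n : ℕ) : conjKernel (nHit κ n) θ = nHit κ n := by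
  rw [conjKernel_nHit, hκ]

/-- **`(κⁿ g)(θ x) = (κⁿ (g ∘ θ))(x)`** for a `θ`-symmetric update: one-step (and `n`-step) conditional expectations read
through the symmetry. -/
theorem integral_nHit_apply_symm (hκ : conjKernel κ θ = κ) {E : Type*} [NormedAddCommGroup E] [NormedSpace ℝ E]
    (g : Ω → E) (n : ℕ) (x : Ω) :
    ∫ y, g y ∂(nHit κ n (θ x)) = ∫ w, g (θ w) ∂(nHit κ n x) := by
  have h := integral_conjKernel (nHit κ n) θ (θ x) g
  rwa [conjKernel_nHit_of_symm hκ n, MeasurableEquiv.symm_apply_apply] at h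

/-- **`κⁿ` maps `θ`-odd observables to `θ`-odd observables.** -/
theorem nHit_odd (hκ : conjKernel κ θ = κ) {B : Ω → ℝ} (hB : ∀ x, B (θ x) = -B x) (n : ℕ) (x : Ω) :
    ∫ y, B y ∂(nHit κ n (θ x)) = -∫ y, B y ∂(nHit κ n x) := by
  rw [integral_nHit_apply_symm hκ B n x]
  simp only [hB, integral_neg]

/-- **`κⁿ` maps `θ`-even observables to `θ`-even observables.** -/
theorem nHit_even (hκ : conjKernel κ θ = κ) {B : Ω → ℝ} (hB : ∀ x, B (θ x) = B x) (n : ℕ) (x : Ω) :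
    ∫ y, B y ∂(nHit κ n (θ x)) = ∫ y, B y ∂(nHit κ n x) := by
  rw [integral_nHit_apply_symm hκ B n x]
  simp only [hB]

end Symm

/-! ## §3 Odd and even observables are uncorrelated at every lag -/

section Decorrelation

variable {κ : Kernel Ω Ω} {θ : Ω ≃ᵐ Ω} {ν : Measure Ω}

/-- **ODD × EVEN: `∫ A · (κⁿ B) dν = 0` AT EVERY LAG** for a `θ`-symmetric update `κ`, a `θ`-invariant `ν`, `A` odd and
`B` even under `θ` — the stationary lagged cross-moment `𝔼_ν[A(X₀) B(X_n)]` of the chain vanishes identically. -/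
theorem integral_mul_nHit_eq_zero_of_odd_even (hκ : conjKernel κ θ = κ) (hν : ν.map θ = ν) {A B : Ω → ℝ}
    (hA : ∀ x, A (θ x) = -A x) (hB : ∀ x, B (θ x) = B x) (n : ℕ) :
    ∫ x, A x * (∫ y, B y ∂(nHit κ n x)) ∂ν = 0 := by
  have h := crossCorrelation_conjKernel_nHit κ θ ν A B n
  rw [hκ, hν] at h
  simp only [hA, hB, neg_mul, integral_neg] at h
  linarith

/-- **EVEN × ODD: `∫ A · (κⁿ B) dν = 0` AT EVERY LAG** for `A` even and `B` odd. -/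
theorem integral_mul_nHit_eq_zero_of_even_odd (hκ : conjKernel κ θ = κ) (hν : ν.map θ = ν) {A B : Ω → ℝ}
    (hA : ∀ x, A (θ x) = A x) (hB : ∀ x, B (θ x) = -B x) (n : ℕ) :
    ∫ x, A x * (∫ y, B y ∂(nHit κ n x)) ∂ν = 0 := by
  have h := crossCorrelation_conjKernel_nHit κ θ ν A B n
  rw [hκ, hν] at h
  simp only [hA, hB, integral_neg, mul_neg, integral_neg] at h
  linarith

/-- **THE LAGGED CROSS-COVARIANCE OF AN ODD AND AN EVEN OBSERVABLE IS ZERO AT EVERY LAG**: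
`𝔼_ν[A(X₀) B(X_n)] − 𝔼_ν[A] · 𝔼_ν[(κⁿB)] = 0` (`A` odd, `B` even; both terms vanish separately). -/
theorem crossCov_nHit_eq_zero_of_odd_even (hκ : conjKernel κ θ = κ) (hν : ν.map θ = ν) {A B : Ω → ℝ}
    (hA : ∀ x, A (θ x) = -A x) (hB : ∀ x, B (θ x) = B x) (n : ℕ) :
    ∫ x, A x * (∫ y, B y ∂(nHit κ n x)) ∂ν - (∫ x, A x ∂ν) * ∫ x, (∫ y, B y ∂(nHit κ n x)) ∂ν = 0 := by
  rw [integral_mul_nHit_eq_zero_of_odd_even hκ hν hA hB n,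
    Scoring.integral_eq_zero_of_measurePreserving_odd θ ⟨θ.measurable, hν⟩ hA, zero_mul, sub_zero]

/-- The same in the other order: `𝔼_ν[A(X₀) B(X_n)] − 𝔼_ν[A] · 𝔼_ν[(κⁿB)] = 0` for `A` even, `B` odd (the second mean
vanishes because `κⁿB` is odd, `nHit_odd`). -/
theorem crossCov_nHit_eq_zero_of_even_odd (hκ : conjKernel κ θ = κ) (hν : ν.map θ = ν) {A B : Ω → ℝ}
    (hA : ∀ x, A (θ x) = A x) (hB : ∀ x, B (θ x) = -B x) (n : ℕ) :
    ∫ x, A x * (∫ y, B y ∂(nHit κ n x)) ∂ν - (∫ x, A x ∂ν) * ∫ x, (∫ y, B y ∂(nHit κ n x)) ∂ν = 0 := by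
  rw [integral_mul_nHit_eq_zero_of_even_odd hκ hν hA hB n,
    Scoring.integral_eq_zero_of_measurePreserving_odd θ ⟨θ.measurable, hν⟩ (F := fun x => ∫ y, B y ∂(nHit κ n x))
      (fun x => nHit_odd hκ hB n x), mul_zero, sub_zero]

/-- **Squares of odd observables are even**, so `𝔼_ν[A(X₀) · A²(X_n)] = 0` at every lag: the charge and its square are
uncorrelated along the chain (`A = Q`). -/
theorem integral_mul_nHit_sq_eq_zero_of_odd (hκ : conjKernel κ θ = κ) (hν : ν.map θ = ν) {A : Ω → ℝ}
    (hA : ∀ x, A (θ x) = -A x) (n : ℕ) :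
    ∫ x, A x * (∫ y, A y ^ 2 ∂(nHit κ n x)) ∂ν = 0 :=
  integral_mul_nHit_eq_zero_of_odd_even hκ hν hA (fun x => by rw [hA, neg_sq]) n

/-- And in the other order: `𝔼_ν[A²(X₀) · A(X_n)] = 0` at every lag. -/
theorem integral_sq_mul_nHit_eq_zero_of_odd (hκ : conjKernel κ θ = κ) (hν : ν.map θ = ν) {A : Ω → ℝ}
    (hA : ∀ x, A (θ x) = -A x) (n : ℕ) :
    ∫ x, A x ^ 2 * (∫ y, A y ∂(nHit κ n x)) ∂ν = 0 :=
  integral_mul_nHit_eq_zero_of_even_odd hκ hν (fun x => by rw [hA, neg_sq]) hA n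

end Decorrelation

/-! ## §4 Arm E2: the measured charge and its square are uncorrelated at every lag, at every step of the run -/

section ArmE2

open Summit.Ventures.LatticeQCDFlow.Scoring
open Literature.MathematicalPhysics.QuantumFieldTheory
open Literature.MathematicalPhysics.QuantumLattice (fundamentalRep cloverPseudoscalar)

variable {L n : ℕ} [NeZero L] (B : Literature.MathematicalPhysics.QuantumFieldTheory.Luscher2010.SuBasis n) (β ε : ℝ)
  (w : List MDOp)

/-- **ARM E2 (row 16's HMC kernel `hmcKernel B β ε w`: Gaussian refresh, any kick–drift trajectory, Metropolis test): under every
`Θ'`-invariant law `ν` the measured flowed charge `Q_{ε',m} = Σ_x P_x ∘ RK3_{ε'}^m` and its square are uncorrelated at every lag `k`**,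
`∫ Q_{ε',m}(U) · (κᵏ Q²_{ε',m})(U) dν = 0` — the kernel commutes with `Θ'` (`conjKernel_hmcKernel`) and `Q_{ε',m}` is `Θ'`-odd
(`sum_cloverPseudoscalar_iterate_wilsonFlowRK3_negReflect`). -/
theorem rk3CloverCharge_mul_nHit_sq_eq_zero {ν : Measure (GaugeConfig 4 L (Matrix.specialUnitaryGroup (Fin n) ℂ))}
    (hν : ν.map GaugeConfig.negReflect = ν) (k : ℕ) (ε' : ℝ) (m : ℕ) :
    ∫ U, (∑ x : Site 4 L, cloverPseudoscalar (fundamentalRep (Fin n)) x ((wilsonFlowRK3 ε')^[m] U)) *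
        (∫ V, (∑ x : Site 4 L, cloverPseudoscalar (fundamentalRep (Fin n)) x ((wilsonFlowRK3 ε')^[m] V)) ^ 2
          ∂(nHit (hmcKernel B β ε w) k U)) ∂ν = 0 :=
  integral_mul_nHit_sq_eq_zero_of_odd (θ := WilsonSiteRP.negReflectEquiv) (conjKernel_hmcKernel B β ε w) hν
    (fun U => sum_cloverPseudoscalar_iterate_wilsonFlowRK3_negReflect ε' m U) k

/-- **AT EVERY STEP OF THE RUN**: from any `Θ'`-invariant start `μ₀`, `𝔼[Q_{ε',m}(U_N) · Q²_{ε',m}(U_{N+k})] = 0` for every `N`, `k`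
(the `N`-step law `μ₀κᴺ` is `Θ'`-invariant, row 16's `map_bind_nHit_eq_self`). -/
theorem rk3CloverCharge_mul_nHit_sq_hmcChain_eq_zero {μ₀ : Measure (GaugeConfig 4 L (Matrix.specialUnitaryGroup (Fin n) ℂ))}
    (hμ₀ : μ₀.map GaugeConfig.negReflect = μ₀) (N k : ℕ) (ε' : ℝ) (m : ℕ) :
    ∫ U, (∑ x : Site 4 L, cloverPseudoscalar (fundamentalRep (Fin n)) x ((wilsonFlowRK3 ε')^[m] U)) *
        (∫ V, (∑ x : Site 4 L, cloverPseudoscalar (fundamentalRep (Fin n)) x ((wilsonFlowRK3 ε')^[m] V)) ^ 2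
          ∂(nHit (hmcKernel B β ε w) k U)) ∂(μ₀.bind (nHit (hmcKernel B β ε w) N)) = 0 :=
  rk3CloverCharge_mul_nHit_sq_eq_zero B β ε w
    (map_bind_nHit_eq_self (conjKernel_hmcKernel B β ε w) hμ₀ N) k ε' m

/-- **Cold start** (`U ≡ 1`): `𝔼[Q_{ε',m}(U_N) · Q²_{ε',m}(U_{N+k})] = 0` for every `N`, `k`. -/
theorem rk3CloverCharge_mul_nHit_sq_hmcColdStart_eq_zero (N k : ℕ) (ε' : ℝ) (m : ℕ) :
    ∫ U, (∑ x : Site 4 L, cloverPseudoscalar (fundamentalRep (Fin n)) x ((wilsonFlowRK3 ε')^[m] U)) *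
        (∫ V, (∑ x : Site 4 L, cloverPseudoscalar (fundamentalRep (Fin n)) x ((wilsonFlowRK3 ε')^[m] V)) ^ 2
          ∂(nHit (hmcKernel B β ε w) k U))
      ∂((Measure.dirac (1 : GaugeConfig 4 L (Matrix.specialUnitaryGroup (Fin n) ℂ))).bind (nHit (hmcKernel B β ε w) N)) = 0 :=
  rk3CloverCharge_mul_nHit_sq_hmcChain_eq_zero B β ε w dirac_one_map_negReflect N k ε' m

/-- **Hot start** (`∏ dHaar`): `𝔼[Q_{ε',m}(U_N) · Q²_{ε',m}(U_{N+k})] = 0` for every `N`, `k`. -/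
theorem rk3CloverCharge_mul_nHit_sq_hmcHotStart_eq_zero (N k : ℕ) (ε' : ℝ) (m : ℕ) :
    ∫ U, (∑ x : Site 4 L, cloverPseudoscalar (fundamentalRep (Fin n)) x ((wilsonFlowRK3 ε')^[m] U)) *
        (∫ V, (∑ x : Site 4 L, cloverPseudoscalar (fundamentalRep (Fin n)) x ((wilsonFlowRK3 ε')^[m] V)) ^ 2
          ∂(nHit (hmcKernel B β ε w) k U))
      ∂((Measure.pi fun _ : Edge 4 L => haarProbability (Matrix.specialUnitaryGroup (Fin n) ℂ)).bind
        (nHit (hmcKernel B β ε w) N)) = 0 :=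
  rk3CloverCharge_mul_nHit_sq_hmcChain_eq_zero B β ε w piHaar_map_negReflect N k ε' m

end ArmE2

end Summit.Ventures.LatticeQCDFlow.Exactness
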